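/- Copyright: the b2b-balaban cell (near-miss cell 7), T⁴-continuum fan-out, NE7b crux-team leaf lineage
`t4-ne7b-formalise-leaf-05` (gens 115–116) — INTERFACE REQUEST NE7b IR-100-3 PART 2 (OWNER `t4-ne7b-p1` g101, CLAIMS.log
l.48029; the named-interface exception of FREEZE (0)): (α)-instance, (A3) module J4, THE JUNCTION PROPER «IR-100-2's
`StepDisplaysAt` AT THE PROCESS CARRIERS ⟹ IR-100-1 (A)'s `HwPinned`» (roadmap W-ne7bp1-g100-2 l.47697; index token D-J4-1 =
(α′), ruling W-ne7bp1-g100-3 l.47754; volume letter = (A) v2's LATTICE letter `ΛexpL`, ruling R-ne7bp1-g101-1 l.48029).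
Released under the licence of the surrounding project. -/
import Summits.QuantumFields.BalabanUV.T4Continuum.Support.B16HistoryStepDisplayPinned
import Summits.QuantumFields.BalabanUV.T4Continuum.Support.HistoryGenealogyStepPairs
import Literature.MathematicalPhysics.QuantumFieldTheory.Balaban1983to89.B16StepFactorsPrinted

/-!
# (α)-INSTANCE, (A3) module J4 — THE JUNCTION PROPER: print's per-step factor sentences (IR-100-2 `StepDisplaysAt`) AT THE
CARRIERS READ OFF THE TOWER AND THE CELL's PROCESS imply the pinned per-step display `HwPinned` (IR-100-1 (A)) at the SHARP
printed letters

Summits-side support leaf of the T⁴-continuum cell (rung (B)+1 on a FINITE torus only; NOT infinite volume, NOT the mass gap,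
NOT Clay; NOT a proof of NE7b — the cell's OWN estimate `T4WeightBudget.RelWeightBound`, NOT PRINTED, NOT PROVED).  [folklore]
real arithmetic + the regrouping identities of `HistoryGenealogyStepPairs` (IR-100-3 part 1) over J2b (`StepReading.wStep`,
`lf`), IR-100-1 (A) v2 (`HwPinned`, `fBexp`, `fRexp`, `ΛexpL`) and IR-100-2 (`StepCarriers`, `Consts`, `StepDisplaysAt`);
nothing printed is asserted (IR-100-2's `StepDisplaysAt` enters as a displayed HYPOTHESIS per run and step), no `def … : Prop`,
no cite-tagged hypothesis, zero `sorry`.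

WHAT IS DEFINED AND PROVED (OWNER roadmap l.47697, J4-a ∕ J4-c; J4-b = `HistoryGenealogyStepPairs`).
* (J4-a) `StepData d P` — print's abstract per-step carrier FUNCTIONS at the cell's index type `Lab d × ℕ` (what (A1c) supplies
  per run `K`, step `j`, prefix `g`): `dC bfac lfPrep : P → Lab d × ℕ → ℝ`, `vfac volZ dZ gInt aInt volZΩ : P → ℝ`;
  **`carriersOf T 𝒮 D K j g X : StepCarriers D j`** with `Choice := P`, `V := C K (j+1)`, `ι := Lab d × ℕ`,
  `T1 p v := ((T K).op j g p).T 1 v`, `comps p := (𝒮.runPartial K (j+1) (snoc g p)).histM.newPairs (j+1)`,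
  `primed p := (…).histM.rnwPairs (…).rnwM (j+1)` and the `StepData` functions; `rfl` projection lemmas.
* §2 the SHARP LETTERS at the (α′) index token: `sBsharp D c K ℓ d′ := γ₀·minConst B₃ A₀ A₁·p₀(g^K_ℓ)²·(d′+1)` (IR-100-2 (F)
  at `g_{j+1}` for the births of level `j+1` = IR-100-1 (B)'s `sB380` up to the letter tables) and `sRsharp D c K h :=
  R(g^K_h)^{−(d+5)}·p₁(g^K_h)²` ((P) at `g_j` for the parts renewed by the level-`j` operation = (B)'s `sRprep`);
  `fBexp_sBsharp` ∕ `fRexp_sRsharp` (the pinned factors ARE print's right members, by `neg_mul`).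
* §3 (J4-c) **`hwPinned_of_stepDisplaysAt`**: `StepDisplaysAt (D K) j (carriersOf T 𝒮 (D K) K j g (X K j g)) c` for every
  `K ≥ K₀, j, g` + `hclass` (print's `d′` of the pair's region = the cell's class `𝒮.κ K`, Q-J3-3, DISPLAYED) + `hvol` (the
  volume side `gInt·aInt·vfac ≤ ∏_{c ∈ comp (j+1)} ΛexpL^{#c.2}` at (A) v2's lattice letter `ΛexpL cΛ M d gs 𝒮.R`, Q-J3-1,
  DISPLAYED, one hypothesis per step) ⟹ `HwPinned T 𝒮 (sBsharp D c) (sRsharp D c) cΛ M gs K₀` (`gs K` = run `K`'s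
  coupling sequence, natural choice `(D K).flow.g`; `hℓ : 0 ≤ ℓ_j` on the performed range, (A) v2's `one_le_ΛexpL`).
  Proof = (Y), then `le_prod_levelShape` at level `j+1` with (F) + `hclass` on the new-region pairs and (P) on the
  renewed-part pairs, then `hvol`; the degenerate branch `gInt·aInt·vfac < 0` is closed by `wStep_nonneg` (IR-100-2's (V)
  does not display `0 ≤ vfac`, so no such hypothesis is added).  THREE FORMS: the CORE `hwPinned_of_stepDisplaysAt_of_bfac_le`
  (hypothesis `hbfac`: each new-region pair's fundamental factor ≤ the pinned birth factor at the class of its region — the ONE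
  place print's `d′` meets the cell's `κ`), the `=` junction `hwPinned_of_stepDisplaysAt` (`hclass : dC = κ`) and the `≤`
  junction `hwPinned_of_stepDisplaysAt_le` (`hclassle : κ ≤ dC` + print's sign `0 ≤ γ₀`; refuter F293 (1)) — the OWNER picks
  the form (A1c)'s data inhabit.
* §4 (J4.1, optional discharge of `hvol`; refuter F293 (2)) **`hvol_of_chain`**: conjuncts (V) + (I) of `StepDisplaysAt` at the
  process carriers + ONE displayed chain in CUBE-COUNT form `hchain : C′·|Z ∩ Ω| + C380·log g_{j+1}⁻²·|Z_{j+1}| ≤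
  uvolL cΛ M d (gs K) (𝒮.R K) K (j+1) · #cubes of the level-(j+1) components` ⟹ `hvol` (`prod_ΛexpL_pow_eq_exp_sum`: the
  per-cube costs multiply to one exponential of the total cube count); `hwPinned_of_stepDisplaysAt_chain` = (J4-c) + (J4.1).

NOT HERE (honest).  Which `T`, `𝒮`, `X`, `D`, `gs` are Bałaban's ((A1c) DATA); `StepFactorsPrinted` for his construction
(print's Theorem 1 — a conditional citation, IR-100-2); the chain `hchain` itself (print's p. 380 l. 15–17 first member read per
`M·R`-cube — displayed, not derived; dischargeable later from `1 ≤ ℓ_{j+1}`, `|Z ∩ Ω| ≤ |Z|`, `C380 + C′ ≤ cΛ` and a cube-count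
reading of `|Z|`, owner l.48029); any valuation; M5.  BY-NAME EFFECT ON THE WALL (`WALL-NE7b-P1.md` §2): NONE by this file
alone (R2 stays «reading» until (A1c)'s data inhabit the displayed hypotheses).  HONEST DEPENDENCY (cell): continuum YM on T⁴
⇐ BetaPertH ∧ nine spine estimates (0/9 proved); BetaPertH ⇐ (D1) ∧ (D4) ∧ CAP+tail; G-an2-4 gates asym, D1 and NE2/3/4.
This file changes none of it. -/

open Finset
open Literature.MathematicalPhysics.QuantumFieldTheory.Balaban1983to89
open Literature.MathematicalPhysics.QuantumFieldTheory.Balaban1983to89.B16LargeFieldFactors380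
open Literature.MathematicalPhysics.QuantumFieldTheory.Balaban1983to89.B16StepFactorsPrinted
open Summit.QuantumFields.BalabanUV.T4Continuum.HistoryGenealogyExtraction
open Summit.QuantumFields.BalabanUV.T4Continuum.HistoryGenealogyRealise
open Summit.QuantumFields.BalabanUV.T4Continuum.HistoryGenealogyInstantiate
open Summit.QuantumFields.BalabanUV.T4Continuum.B16HistoryIndexedRepr
open Summit.QuantumFields.BalabanUV.T4Continuum.B16HistoryReprChain
open Summit.QuantumFields.BalabanUV.T4Continuum.B16HistoryReprInstance
open Summit.QuantumFields.BalabanUV.T4Continuum.B16HistoryReprReadCausal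
open Summit.QuantumFields.BalabanUV.T4Continuum.B16HistoryStepDisplayPinned
open Summit.QuantumFields.BalabanUV.T4Continuum.HistoryBankingSharpShares (ell)
open Summit.QuantumFields.BalabanUV.T4Continuum.HistoryBankingVolumeWindowLattice (uvolL)

namespace Summit.QuantumFields.BalabanUV.T4Continuum.B16HistoryStepJunction

noncomputable section

/-! ## §1 (J4-a) Print's abstract per-step carrier functions and THE CARRIERS READ OFF THE TOWER AND THE PROCESS -/

section Carriers

variable {P : Type} {d : ℕ} {C : ℕ → ℕ → Type} {𝒢 : (K j : ℕ) → GoodClass (C K j)}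

/-- **(J4-a) PRINT's ABSTRACT PER-STEP CARRIER FUNCTIONS** for ONE step (run `K`, step `j`, prefix `g` fixed outside), at
the cell's component index `Lab d × ℕ` = (component of the level the step forms, position in its `news` ∕ `parts` list):
per choice `p` and pair `x`, the linear size `dC p x`, the fundamental factor `bfac p x`, the preparatory factor `lfPrep p x`;
per choice the volume-side carriers `vfac volZ dZ gInt aInt volZΩ` (IR-100-2's `StepCarriers` fields of the same names).
Pure data ((A1c) supplies Bałaban's); nothing asserted. [folklore] -/
structure StepData (d : ℕ) (P : Type) where
  /-- `d′` of the pair's region, the fundamental factor and the preparatory factor, per (choice, pair) -/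
  (dC bfac lfPrep : P → Lab d × ℕ → ℝ)
  /-- the volume-side carriers per choice (p. 380 l. 12–18, p. 383 l. 21–24) -/
  (vfac volZ dZ gInt aInt volZΩ : P → ℝ)

/-- **(J4-a) THE CARRIERS OF STEP `j` OF RUN `K` AFTER THE PREFIX `g`, READ OFF THE TOWER `T` AND THE CELL's PROCESS**:
choices `P`, remaining variables `C K (j+1)`, `T1 p v := ((T K).op j g p).T 1 v` (the unit weight of the one-step map of
the choice), index type `Lab d × ℕ`, `comps p` = the NEW-REGION PAIRS and `primed p` = the RENEWED-PART PAIRS of the level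
`j+1` of the process run on the input read off `snoc g p` (`HistoryGenealogyStepPairs`), the remaining fields from `X`.
[folklore] -/
def carriersOf (T : (K : ℕ) → Tower P (C K) (𝒢 K)) (𝒮 : StepReading P d) (D : B16.RunData) (K j : ℕ) (g : Fin j → P)
    (X : StepData d P) : StepCarriers D j where
  Choice := P
  V := C K (j + 1)
  ι := Lab d × ℕ
  T1 p v := ((T K).op j g p).T (fun _ => 1) v
  comps p := (𝒮.runPartial K (j + 1) (Fin.snoc g p)).histM.newPairs (j + 1)
  primed p := (𝒮.runPartial K (j + 1) (Fin.snoc g p)).histM.rnwPairs (𝒮.runPartial K (j + 1) (Fin.snoc g p)).rnwM (j + 1)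
  dC := X.dC
  bfac := X.bfac
  lfPrep := X.lfPrep
  vfac := X.vfac
  volZ := X.volZ
  dZ := X.dZ
  gInt := X.gInt
  aInt := X.aInt
  volZΩ := X.volZΩ

variable (T : (K : ℕ) → Tower P (C K) (𝒢 K)) (𝒮 : StepReading P d) (D : B16.RunData) (K j : ℕ) (g : Fin j → P)
  (X : StepData d P)

/-- the carriers' unit weight is the one-step map's unit weight [folklore] -/
@[simp] theorem carriersOf_T1 (p : P) (v : C K (j + 1)) :
    (carriersOf T 𝒮 D K j g X).T1 p v = ((T K).op j g p).T (fun _ => 1) v := rfl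

/-- the carriers' components are the new-region pairs of the level the step forms [folklore] -/
@[simp] theorem carriersOf_comps (p : P) :
    (carriersOf T 𝒮 D K j g X).comps p = (𝒮.runPartial K (j + 1) (Fin.snoc g p)).histM.newPairs (j + 1) := rfl

/-- the carriers' primed components are the renewed-part pairs of the level the step forms [folklore] -/
@[simp] theorem carriersOf_primed (p : P) :
    (carriersOf T 𝒮 D K j g X).primed p =
      (𝒮.runPartial K (j + 1) (Fin.snoc g p)).histM.rnwPairs (𝒮.runPartial K (j + 1) (Fin.snoc g p)).rnwM (j + 1) :=
  rfl

/-- the carriers' linear sizes are `X`'s [folklore] -/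
@[simp] theorem carriersOf_dC (p : P) (y : Lab d × ℕ) : (carriersOf T 𝒮 D K j g X).dC p y = X.dC p y := rfl

/-- the carriers' fundamental factors are `X`'s [folklore] -/
@[simp] theorem carriersOf_bfac (p : P) (y : Lab d × ℕ) : (carriersOf T 𝒮 D K j g X).bfac p y = X.bfac p y := rfl

/-- the carriers' preparatory factors are `X`'s [folklore] -/
@[simp] theorem carriersOf_lfPrep (p : P) (y : Lab d × ℕ) : (carriersOf T 𝒮 D K j g X).lfPrep p y = X.lfPrep p y := rfl

/-- the carriers' volume constants are `X`'s [folklore] -/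
@[simp] theorem carriersOf_vfac (p : P) : (carriersOf T 𝒮 D K j g X).vfac p = X.vfac p := rfl

/-- the carriers' region volumes are `X`'s [folklore] -/
@[simp] theorem carriersOf_volZ (p : P) : (carriersOf T 𝒮 D K j g X).volZ p = X.volZ p := rfl

/-- the carriers' region linear sizes are `X`'s [folklore] -/
@[simp] theorem carriersOf_dZ (p : P) : (carriersOf T 𝒮 D K j g X).dZ p = X.dZ p := rfl

/-- the carriers' Gaussian-integration constants are `X`'s [folklore] -/
@[simp] theorem carriersOf_gInt (p : P) : (carriersOf T 𝒮 D K j g X).gInt p = X.gInt p := rfl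

/-- the carriers' small-field-integration constants are `X`'s [folklore] -/
@[simp] theorem carriersOf_aInt (p : P) : (carriersOf T 𝒮 D K j g X).aInt p = X.aInt p := rfl

/-- the carriers' `|Z ∩ Ω|`-volumes are `X`'s [folklore] -/
@[simp] theorem carriersOf_volZΩ (p : P) : (carriersOf T 𝒮 D K j g X).volZΩ p = X.volZΩ p := rfl

/-- the carriers' per-pair and per-choice functions are `X`'s (nine `rfl`s in one) [folklore] -/
theorem carriersOf_fields :
    (carriersOf T 𝒮 D K j g X).dC = X.dC ∧ (carriersOf T 𝒮 D K j g X).bfac = X.bfac ∧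
      (carriersOf T 𝒮 D K j g X).lfPrep = X.lfPrep ∧ (carriersOf T 𝒮 D K j g X).vfac = X.vfac ∧
        (carriersOf T 𝒮 D K j g X).volZ = X.volZ ∧ (carriersOf T 𝒮 D K j g X).dZ = X.dZ ∧
          (carriersOf T 𝒮 D K j g X).gInt = X.gInt ∧ (carriersOf T 𝒮 D K j g X).aInt = X.aInt ∧
            (carriersOf T 𝒮 D K j g X).volZΩ = X.volZΩ :=
  ⟨rfl, rfl, rfl, rfl, rfl, rfl, rfl, rfl, rfl⟩

end Carriers

/-! ## §2 The SHARP printed letters at the (α′) index token -/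

section Letters

variable (D : ℕ → B16.RunData) (c : B16StepFactorsPrinted.Consts)

/-- **THE SHARP BIRTH LETTER** of run `K`, level `ℓ`, class `d′`: `γ₀ · minConst B₃ A₀ A₁ · p₀(g^K_ℓ)² · (d′ + 1)` — the
exponent of IR-100-2's conjunct (F) read, per the (α′) token, at the coupling of the level the regions are born at (for the
tower step `j`: `ℓ = j + 1`); = IR-100-1 (B)'s `sB380` up to the letter tables.  An abbreviation. [folklore] -/
def sBsharp (K ℓ d' : ℕ) : ℝ :=
  c.γ₀ * minConst c.B₃ c.A₀ c.A₁ * p0Profile c.A₀ c.p₀ ((D K).flow.g ℓ) ^ 2 * ((d' : ℝ) + 1)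

/-- **THE SHARP RENEWAL LETTER** of run `K`, level `h`: `R(g^K_h)^{−(d+5)} · p₁(g^K_h)²` — the exponent of IR-100-2's
conjunct (P) at the coupling of the level of the PRIMED component (tower step `j` renews parts of level `j`: `h = j`);
= IR-100-1 (B)'s `sRprep` with IR-100-2's profiles.  An abbreviation. [folklore] -/
def sRsharp (K h : ℕ) : ℝ :=
  (c.R ((D K).flow.g h) ^ (c.d + 5))⁻¹ * c.P1 ((D K).flow.g h) ^ 2

/-- the pinned birth factor at the sharp letter IS (F)'s right member at `dC = d′` [folklore] -/
theorem fBexp_sBsharp {d : ℕ} (K ℓ d' : ℕ) (n : Lab d) :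
    fBexp (sBsharp D c) K ℓ d' n =
      Real.exp (-(c.γ₀ * minConst c.B₃ c.A₀ c.A₁ * p0Profile c.A₀ c.p₀ ((D K).flow.g ℓ) ^ 2 * ((d' : ℝ) + 1))) :=
  rfl

/-- the pinned renewal factor at the sharp letter IS (P)'s right member [folklore] -/
theorem fRexp_sRsharp (K h : ℕ) :
    fRexp (sRsharp D c) K h = Real.exp (-(c.R ((D K).flow.g h) ^ (c.d + 5))⁻¹ * c.P1 ((D K).flow.g h) ^ 2) := by
  unfold fRexp sRsharp
  rw [neg_mul]

end Letters

/-! ## §3 (J4-c) THE JUNCTION: print's per-step sentences at the process carriers ⟹ the pinned display -/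

section Junction

variable {P : Type} {d : ℕ} {C : ℕ → ℕ → Type} {𝒢 : (K j : ℕ) → GoodClass (C K j)}
  (T : (K : ℕ) → Tower P (C K) (𝒢 K)) (𝒮 : StepReading P d) (D : ℕ → B16.RunData) (c : B16StepFactorsPrinted.Consts)
  (X : (K j : ℕ) → (Fin j → P) → StepData d P) (cΛ M : ℝ) (gs : ℕ → ℕ → ℝ)

/-- **(J4-c) THE JUNCTION, CORE FORM.**  If, for every run `K ≥ K₀`, step `j` and prefix `g`, print's per-step factor
sentences (IR-100-2 `StepDisplaysAt`, (α′) token) hold AT THE CARRIERS READ OFF THE TOWER AND THE PROCESS (`carriersOf`),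
if every fundamental factor of a new-region pair is at most the PINNED birth factor at the sharp letter of the region's CLASS
(`hbfac` — the one place where print's linear size `d′` meets the cell's class `κ`; the two class junctions below discharge
it from (F)), and if the volume side is dominated by the per-cube costs of the components of the level the step forms
(`hvol`, Q-J3-1), then the PINNED PER-STEP DISPLAY `HwPinned` of IR-100-1 (A) holds at the SHARP letters `sBsharp`,
`sRsharp`.  Proof: (Y); `HistoryGenealogyStepPairs.le_prod_levelShape` at level `j+1` with `b := bfac p` bounded by
`hbfac`, `l := lfPrep p` bounded by (P) (= `fRexp sRsharp K j`), `A := gInt·aInt·vfac ≤ ∏ ΛexpL^{#c.2}` by `hvol`; the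
branch `A < 0` by `wStep_nonneg` (IR-100-2's (V) does not display `0 ≤ vfac`, so no such hypothesis is added).  Nothing of
Bałaban's is asserted: the hypotheses are displayed. [folklore] -/
theorem hwPinned_of_stepDisplaysAt_of_bfac_le {K₀ : ℕ} (hc : 0 ≤ cΛ) (hM : 0 ≤ M) (hℓ : ∀ K j, j ≤ K → 0 ≤ ell (gs K) j)
    (hdisp : ∀ K, K₀ ≤ K → ∀ (j : ℕ) (g : Fin j → P),
      StepDisplaysAt (D K) j (carriersOf T 𝒮 (D K) K j g (X K j g)) c)
    (hbfac : ∀ K, K₀ ≤ K → ∀ (j : ℕ) (g : Fin j → P) (p : P),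
      ∀ x ∈ (𝒮.runPartial K (j + 1) (Fin.snoc g p)).histM.newPairs (j + 1),
        (X K j g).bfac p x ≤
          fBexp (sBsharp D c) K (j + 1) (𝒮.κ K ((𝒮.runPartial K (j + 1) (Fin.snoc g p)).histM.newAt (j + 1) x))
            ((𝒮.runPartial K (j + 1) (Fin.snoc g p)).histM.newAt (j + 1) x))
    (hvol : ∀ K, K₀ ≤ K → ∀ (j : ℕ) (g : Fin j → P) (p : P),
      (X K j g).gInt p * (X K j g).aInt p * (X K j g).vfac p ≤
        ∏ cc ∈ (𝒮.runPartial K (j + 1) (Fin.snoc g p)).histM.comp (j + 1), ΛexpL cΛ M d gs 𝒮.R K (j + 1) ^ (cc.2).card) :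
    HwPinned T 𝒮 (sBsharp D c) (sRsharp D c) cΛ M gs K₀ := by
  intro K hK j g p x
  obtain ⟨hY, -, hF, hP, -⟩ := hdisp K hK j g
  set J := 𝒮.runPartial K (j + 1) (Fin.snoc g p) with hJ
  -- the flat bound (Y) at the process carriers
  have h1 : ((T K).op j g p).T (fun _ => 1) x ≤
      (X K j g).gInt p * (X K j g).aInt p * (X K j g).vfac p *
        (∏ y ∈ J.histM.newPairs (j + 1), (X K j g).bfac p y) *
          ∏ y ∈ J.histM.rnwPairs J.rnwM (j + 1), (X K j g).lfPrep p y := hY p x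
  have hb0 : ∀ y ∈ J.histM.newPairs (j + 1), 0 ≤ (X K j g).bfac p y := fun y hy => (hF p y hy).2.1
  have hl0 : ∀ y ∈ J.histM.rnwPairs J.rnwM (j + 1), 0 ≤ (X K j g).lfPrep p y := fun y hy => (hP p y hy).1
  have hB0 : 0 ≤ ∏ y ∈ J.histM.newPairs (j + 1), (X K j g).bfac p y := Finset.prod_nonneg hb0
  have hL0 : 0 ≤ ∏ y ∈ J.histM.rnwPairs J.rnwM (j + 1), (X K j g).lfPrep p y := Finset.prod_nonneg hl0
  have hw0 : 0 ≤ 𝒮.wStep (fBexp (sBsharp D c)) (fRexp (sRsharp D c)) (ΛexpL cΛ M d gs 𝒮.R) K j g p :=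
    𝒮.wStep_nonneg _ _ _ (fBexp_nonneg _) (fRexp_nonneg _) (one_le_ΛexpL cΛ M gs 𝒮.R hc hM hℓ) K j g p
  by_cases hA0 : 0 ≤ (X K j g).gInt p * (X K j g).aInt p * (X K j g).vfac p
  swap
  · -- degenerate branch: a negative volume-side constant makes (Y)'s right member non-positive
    have hneg : (X K j g).gInt p * (X K j g).aInt p * (X K j g).vfac p *
        (∏ y ∈ J.histM.newPairs (j + 1), (X K j g).bfac p y) *
          ∏ y ∈ J.histM.rnwPairs J.rnwM (j + 1), (X K j g).lfPrep p y ≤ 0 := by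
      have hBL := mul_nonneg hB0 hL0
      nlinarith [hBL, lt_of_not_ge hA0]
    exact (h1.trans hneg).trans hw0
  -- main branch: regroup by `le_prod_levelShape` at level `j + 1`
  have hcls : ∀ n, J.histM.cls n = 𝒮.κ K n := fun _ => rfl
  have hb : ∀ y ∈ J.histM.newPairs (j + 1), (X K j g).bfac p y ≤
      fBexp (sBsharp D c) K (j + 1) (J.histM.cls (J.histM.newAt (j + 1) y)) (J.histM.newAt (j + 1) y) := by
    intro y hy
    rw [hcls]
    exact hbfac K hK j g p y hy
  have hl : ∀ y ∈ J.histM.rnwPairs J.rnwM (j + 1), (X K j g).lfPrep p y ≤ fRexp (sRsharp D c) K (j + 1 - 1) := by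
    intro y hy
    rw [Nat.add_sub_cancel, fRexp_sRsharp]
    exact (hP p y hy).2
  have key := J.histM.le_prod_levelShape J.rnwM (j + 1) (fun cc => ΛexpL cΛ M d gs 𝒮.R K (j + 1) ^ (cc.2).card)
    (fun d' n => fBexp (sBsharp D c) K (j + 1) d' n) (fRexp (sRsharp D c) K) J.histM.cls h1 hA0 (hvol K hK j g p)
    hb0 hb hl0 hl
  -- the right member is `wStep` by definition
  unfold StepReading.wStep lf
  exact key

/-- **(J4-c) THE JUNCTION PROPER — CLASS JUNCTION BY EQUALITY.**  As the core form, with `hbfac` discharged from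
IR-100-2's conjunct (F) and the identification `hclass`: print's linear size `d′` of a new-region pair IS the cell's class
of that region (Q-J3-3 in its `=` form).  Then (F)'s right member at `dC = κ` is `fBexp sBsharp K (j+1) κ n` on the nose
(`fBexp_sBsharp`). [folklore] -/
theorem hwPinned_of_stepDisplaysAt {K₀ : ℕ} (hc : 0 ≤ cΛ) (hM : 0 ≤ M) (hℓ : ∀ K j, j ≤ K → 0 ≤ ell (gs K) j)
    (hdisp : ∀ K, K₀ ≤ K → ∀ (j : ℕ) (g : Fin j → P),
      StepDisplaysAt (D K) j (carriersOf T 𝒮 (D K) K j g (X K j g)) c)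
    (hclass : ∀ K, K₀ ≤ K → ∀ (j : ℕ) (g : Fin j → P) (p : P),
      ∀ x ∈ (𝒮.runPartial K (j + 1) (Fin.snoc g p)).histM.newPairs (j + 1),
        (X K j g).dC p x = (𝒮.κ K ((𝒮.runPartial K (j + 1) (Fin.snoc g p)).histM.newAt (j + 1) x) : ℝ))
    (hvol : ∀ K, K₀ ≤ K → ∀ (j : ℕ) (g : Fin j → P) (p : P),
      (X K j g).gInt p * (X K j g).aInt p * (X K j g).vfac p ≤
        ∏ cc ∈ (𝒮.runPartial K (j + 1) (Fin.snoc g p)).histM.comp (j + 1), ΛexpL cΛ M d gs 𝒮.R K (j + 1) ^ (cc.2).card) :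
    HwPinned T 𝒮 (sBsharp D c) (sRsharp D c) cΛ M gs K₀ := by
  refine hwPinned_of_stepDisplaysAt_of_bfac_le T 𝒮 D c X cΛ M gs hc hM hℓ hdisp (fun K hK j g p x hx => ?_) hvol
  have h := ((hdisp K hK j g).2.2.1 p x hx).2.2
  rw [carriersOf_dC, hclass K hK j g p x hx] at h
  rw [fBexp_sBsharp]
  exact h

/-- **(J4-c) THE JUNCTION PROPER — CLASS JUNCTION BY DOMINATION.**  As the core form, with `hbfac` discharged from
IR-100-2's conjunct (F), the WEAKER identification `hclassle`: the cell's class of the region of a new-region pair is AT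
MOST print's linear size `d′` of the pair (Q-J3-3 in its `≤` form — the class may under-count print's `d′_{j+1}(Z)`), and
print's sign `0 ≤ γ₀` (so that the birth exponent `γ₀ · min{…} · p₀² · (d′ + 1)` is monotone in `d′`; `0 ≤ min{…}` and
`0 ≤ p₀²` are automatic).  The `=` form is the special case `le_of_eq`. [folklore] -/
theorem hwPinned_of_stepDisplaysAt_le {K₀ : ℕ} (hc : 0 ≤ cΛ) (hM : 0 ≤ M) (hℓ : ∀ K j, j ≤ K → 0 ≤ ell (gs K) j)
    (hγ : 0 ≤ c.γ₀)
    (hdisp : ∀ K, K₀ ≤ K → ∀ (j : ℕ) (g : Fin j → P),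
      StepDisplaysAt (D K) j (carriersOf T 𝒮 (D K) K j g (X K j g)) c)
    (hclassle : ∀ K, K₀ ≤ K → ∀ (j : ℕ) (g : Fin j → P) (p : P),
      ∀ x ∈ (𝒮.runPartial K (j + 1) (Fin.snoc g p)).histM.newPairs (j + 1),
        (𝒮.κ K ((𝒮.runPartial K (j + 1) (Fin.snoc g p)).histM.newAt (j + 1) x) : ℝ) ≤ (X K j g).dC p x)
    (hvol : ∀ K, K₀ ≤ K → ∀ (j : ℕ) (g : Fin j → P) (p : P),
      (X K j g).gInt p * (X K j g).aInt p * (X K j g).vfac p ≤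
        ∏ cc ∈ (𝒮.runPartial K (j + 1) (Fin.snoc g p)).histM.comp (j + 1), ΛexpL cΛ M d gs 𝒮.R K (j + 1) ^ (cc.2).card) :
    HwPinned T 𝒮 (sBsharp D c) (sRsharp D c) cΛ M gs K₀ := by
  refine hwPinned_of_stepDisplaysAt_of_bfac_le T 𝒮 D c X cΛ M gs hc hM hℓ hdisp (fun K hK j g p x hx => ?_) hvol
  have h := ((hdisp K hK j g).2.2.1 p x hx).2.2
  rw [carriersOf_dC] at h
  rw [fBexp_sBsharp]
  refine h.trans ?_
  rw [Real.exp_le_exp]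
  have hmin : 0 ≤ minConst c.B₃ c.A₀ c.A₁ := le_min (le_min (by positivity) (by positivity)) (sq_nonneg _)
  have hs : 0 ≤ c.γ₀ * minConst c.B₃ c.A₀ c.A₁ * p0Profile c.A₀ c.p₀ ((D K).flow.g (j + 1)) ^ 2 := by positivity
  have hle := mul_le_mul_of_nonneg_left (add_le_add_right (hclassle K hK j g p x hx) 1) hs
  linarith

/-! ## §4 (J4.1) The volume side `hvol` from (V) + (I) + print's p. 380 chain in CUBE-COUNT form -/

/-- the per-cube costs of the components of a level multiply to ONE exponential of the level's total cube count [folklore] -/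
theorem prod_ΛexpL_pow_eq_exp_sum {β : Type*} (Rn : ℕ → ℕ → ℕ) (S : Finset β) (n : β → ℕ) (K t : ℕ) :
    ∏ b ∈ S, ΛexpL cΛ M d gs Rn K t ^ n b = Real.exp (uvolL cΛ M d (gs K) (Rn K) K t * ∑ b ∈ S, (n b : ℝ)) := by
  rw [Finset.mul_sum, Real.exp_sum]
  refine Finset.prod_congr rfl fun b _ => ?_
  unfold ΛexpL
  rw [← Real.exp_nat_mul, mul_comm]

/-- **(J4.1) THE VOLUME SIDE FROM PRINT's SENTENCES** (optional discharge of `hvol`).  Under the step's sentences at the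
process carriers — conjuncts (V) (`vfac ≤ exp(C380 · log g_{j+1}⁻² · |Z_{j+1}|)`, p. 380 l. 12–18) and (I) (`0 ≤ gInt ≤ 1`,
`0 ≤ aInt ≤ exp(C′|Z ∩ Ω|)`, p. 383 l. 21–24) — and given ONE displayed chain for the step's two volume carriers IN CUBE-COUNT
FORM, `hchain : C′·|Z ∩ Ω| + C380 · log g_{j+1}⁻² · |Z_{j+1}| ≤ uvolL cΛ M d (gs K) (𝒮.R K) K (j+1) · #{cubes of the components
of level j+1}` (`uvolL … K t = cΛ·(M·R_{t∧K})^d·ℓ_{t∧K}`, (A) v2's LATTICE letter — print's FIRST member «O(1) log g_j⁻²|Z_j| ≦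
O(1) log g_j⁻²(MR_j)^d d′_j(Z_j)», p. 380 l. 15–17, read per `M·R`-cube onto the cell's components; displayed, not derived;
dischargeable later from `1 ≤ ℓ_{j+1}` on the performed range, `|Z ∩ Ω| ≤ |Z|`, `C380 + C′ ≤ cΛ` and a cube-count reading of
`|Z|`, owner l.48029), the volume side `gInt · aInt · vfac` is at most the product of the per-cube costs `ΛexpL^{#cubes}` over
the components of the level the step forms — i.e. the hypothesis `hvol` of `hwPinned_of_stepDisplaysAt` verbatim.  The branch
`vfac < 0` is closed by `0 ≤ gInt·aInt` and `0 < exp`. [folklore] -/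
theorem hvol_of_chain {K₀ : ℕ}
    (hdisp : ∀ K, K₀ ≤ K → ∀ (j : ℕ) (g : Fin j → P),
      StepDisplaysAt (D K) j (carriersOf T 𝒮 (D K) K j g (X K j g)) c)
    (hchain : ∀ K, K₀ ≤ K → ∀ (j : ℕ) (g : Fin j → P) (p : P),
      c.C' * (X K j g).volZΩ p + c.C380 * Real.log (((D K).flow.g (j + 1)) ^ 2)⁻¹ * (X K j g).volZ p ≤
        uvolL cΛ M d (gs K) (𝒮.R K) K (j + 1) *
          ∑ cc ∈ (𝒮.runPartial K (j + 1) (Fin.snoc g p)).histM.comp (j + 1), ((cc.2).card : ℝ)) :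
    ∀ K, K₀ ≤ K → ∀ (j : ℕ) (g : Fin j → P) (p : P),
      (X K j g).gInt p * (X K j g).aInt p * (X K j g).vfac p ≤
        ∏ cc ∈ (𝒮.runPartial K (j + 1) (Fin.snoc g p)).histM.comp (j + 1), ΛexpL cΛ M d gs 𝒮.R K (j + 1) ^ (cc.2).card := by
  intro K hK j g p
  obtain ⟨-, hV, -, -, hI⟩ := hdisp K hK j g
  have hg0 : 0 ≤ (X K j g).gInt p := (hI p).1
  have hg1 : (X K j g).gInt p ≤ 1 := (hI p).2.1
  have ha0 : 0 ≤ (X K j g).aInt p := (hI p).2.2.1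
  have ha1 : (X K j g).aInt p ≤ Real.exp (c.C' * (X K j g).volZΩ p) := (hI p).2.2.2
  have hv : (X K j g).vfac p ≤ Real.exp (c.C380 * Real.log (((D K).flow.g (j + 1)) ^ 2)⁻¹ * (X K j g).volZ p) :=
    (hV p).2
  have hprod : ∏ cc ∈ (𝒮.runPartial K (j + 1) (Fin.snoc g p)).histM.comp (j + 1),
      ΛexpL cΛ M d gs 𝒮.R K (j + 1) ^ (cc.2).card =
      Real.exp (uvolL cΛ M d (gs K) (𝒮.R K) K (j + 1) *
        ∑ cc ∈ (𝒮.runPartial K (j + 1) (Fin.snoc g p)).histM.comp (j + 1), ((cc.2).card : ℝ)) :=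
    prod_ΛexpL_pow_eq_exp_sum cΛ M gs 𝒮.R ((𝒮.runPartial K (j + 1) (Fin.snoc g p)).histM.comp (j + 1))
      (fun cc => (cc.2).card) K (j + 1)
  rw [hprod]
  by_cases hvf : 0 ≤ (X K j g).vfac p
  · calc (X K j g).gInt p * (X K j g).aInt p * (X K j g).vfac p
          ≤ 1 * Real.exp (c.C' * (X K j g).volZΩ p) *
              Real.exp (c.C380 * Real.log (((D K).flow.g (j + 1)) ^ 2)⁻¹ * (X K j g).volZ p) :=
          mul_le_mul (mul_le_mul hg1 ha1 ha0 zero_le_one) hv hvf (by positivity)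
      _ = Real.exp (c.C' * (X K j g).volZΩ p + c.C380 * Real.log (((D K).flow.g (j + 1)) ^ 2)⁻¹ * (X K j g).volZ p) := by
          rw [one_mul, ← Real.exp_add]
      _ ≤ _ := Real.exp_le_exp.mpr (hchain K hK j g p)
  · have hnp : (X K j g).gInt p * (X K j g).aInt p * (X K j g).vfac p ≤ 0 :=
      mul_nonpos_of_nonneg_of_nonpos (mul_nonneg hg0 ha0) (lt_of_not_ge hvf).le
    exact hnp.trans (Real.exp_pos _).le

/-- **(J4-c) + (J4.1) IN ONE STROKE**: print's per-step sentences at the process carriers + the `=` class junction + p. 380's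
chain in cube-count form ⟹ `HwPinned` at the sharp letters (the three displayed inputs a consumer supplies from (A1c)'s data).
[folklore] -/
theorem hwPinned_of_stepDisplaysAt_chain {K₀ : ℕ} (hc : 0 ≤ cΛ) (hM : 0 ≤ M) (hℓ : ∀ K j, j ≤ K → 0 ≤ ell (gs K) j)
    (hdisp : ∀ K, K₀ ≤ K → ∀ (j : ℕ) (g : Fin j → P),
      StepDisplaysAt (D K) j (carriersOf T 𝒮 (D K) K j g (X K j g)) c)
    (hclass : ∀ K, K₀ ≤ K → ∀ (j : ℕ) (g : Fin j → P) (p : P),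
      ∀ x ∈ (𝒮.runPartial K (j + 1) (Fin.snoc g p)).histM.newPairs (j + 1),
        (X K j g).dC p x = (𝒮.κ K ((𝒮.runPartial K (j + 1) (Fin.snoc g p)).histM.newAt (j + 1) x) : ℝ))
    (hchain : ∀ K, K₀ ≤ K → ∀ (j : ℕ) (g : Fin j → P) (p : P),
      c.C' * (X K j g).volZΩ p + c.C380 * Real.log (((D K).flow.g (j + 1)) ^ 2)⁻¹ * (X K j g).volZ p ≤
        uvolL cΛ M d (gs K) (𝒮.R K) K (j + 1) *
          ∑ cc ∈ (𝒮.runPartial K (j + 1) (Fin.snoc g p)).histM.comp (j + 1), ((cc.2).card : ℝ)) :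
    HwPinned T 𝒮 (sBsharp D c) (sRsharp D c) cΛ M gs K₀ :=
  hwPinned_of_stepDisplaysAt T 𝒮 D c X cΛ M gs hc hM hℓ hdisp hclass (hvol_of_chain T 𝒮 D c X cΛ M gs hdisp hchain)

end Junction

end

end Summit.QuantumFields.BalabanUV.T4Continuum.B16HistoryStepJunction
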